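import Mathlib.LinearAlgebra.Matrix.Trace
import Mathlib.Algebra.BigOperators.Fin
import Mathlib.Tactic.Ring
import Mathlib.Tactic.Positivity
import HarnessLib

/-!
# List matrices: integer matrices as lists of rows, their products, powers, traces and Gram matrices

Trunk T-CPLX-CORE (Literature/Computability/Complexity). Support file for the machine form of the
Allen–O'Donnell–Witmer refuter (the running-time third of the discharge of the named fact
`allen_odonnell_witmer_kSAT`, `AOWRefutation.lean`): the refuter (`AOWAccepts.lean`) tests integer
inequalities on traces of powers of Gram matrices `tr((BᵀB)^q)`; its machine computes them on
matrices held as LISTS OF ROWS of integers. This file is the (machine-free) dictionary: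

* `ent X i j` (entry with default `0`), `tab N₁ N₂ f` (the table of a function), `toMat N₁ N₂ X`
  (the `Matrix (Fin N₁) (Fin N₂) ℤ` of a list of rows), `sumRange`;
* `mulL`, `oneL`, `powL` (and the fold `foldl_mulL`), `traceL`, `gramL` (`BᵀB` from the rows of `B`)
  with `toMat_mulL`, `toMat_oneL`, `toMat_powL`, `traceL_eq_trace`, `toMat_gramL`;
* invariance of `tr((BᵀB)^t)` under re-indexing rows and columns of `B` by equivalences
  (`trace_pow_gram_submatrix`), which transports the refuter's matrices indexed by tuples
  `[n]^a` to the machine's matrices indexed by `range (n^a)` (`finFunctionFinEquiv`);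
* entry bounds `EntryBound` propagated through `mulL`, `gramL`, `powL` (the polynomial size bounds the
  clocked loops of the machine need), and the shape facts `length_tab`, `mem_tab`.

## References

* S. Arora, B. Barak, *Computational Complexity: A Modern Approach*, CUP 2009, §1.3 (polynomial
  time; matrix arithmetic by the schoolbook method).
* D. E. Knuth, *The Art of Computer Programming*, Vol. 2, 3rd ed., 1998, §4.6.4 (evaluation of
  powers and matrix products).
-/

namespace Literature.Computability.Complexity

namespace LMat

open Finset Matrix

/-! ### Entries, tables, sums over ranges -/

/-- Entry `(i, j)` of a list of rows, `0` outside. [folklore] -/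
def ent (X : List (List ℤ)) (i j : ℕ) : ℤ := (X.getD i []).getD j 0

/-- The table of a function: `N₁` rows of `N₂` entries. [folklore] -/
def tab (N₁ N₂ : ℕ) (f : ℕ → ℕ → ℤ) : List (List ℤ) :=
  (List.range N₁).map fun i => (List.range N₂).map fun j => f i j

/-- The matrix of a list of rows. [folklore] -/
def toMat (N₁ N₂ : ℕ) (X : List (List ℤ)) : Matrix (Fin N₁) (Fin N₂) ℤ := fun i j => ent X i j

/-- `∑_{i < N} f i` over a list range. [folklore] -/
def sumRange (N : ℕ) (f : ℕ → ℤ) : ℤ := ((List.range N).map f).sum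

/-- Indexing a mapped range. [folklore] -/
theorem getD_map_range {α : Type} (f : ℕ → α) {i N : ℕ} (hi : i < N) (d : α) :
    ((List.range N).map f).getD i d = f i := by
  rw [List.getD_eq_getElem?_getD, List.getElem?_map, List.getElem?_range hi]
  rfl

/-- Indexing a mapped range out of range gives the default. [folklore] -/
theorem getD_map_range_of_le {α : Type} (f : ℕ → α) {i N : ℕ} (hi : N ≤ i) (d : α) :
    ((List.range N).map f).getD i d = d := by
  rw [List.getD_eq_getElem?_getD, List.getElem?_eq_none (by simpa using hi)]
  rfl

/-- Entries of a table. [folklore] -/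
theorem ent_tab {N₁ N₂ : ℕ} (f : ℕ → ℕ → ℤ) {i j : ℕ} (hi : i < N₁) (hj : j < N₂) :
    ent (tab N₁ N₂ f) i j = f i j := by
  rw [ent, tab, getD_map_range _ hi, getD_map_range _ hj]

/-- The matrix of a table. [folklore] -/
@[simp] theorem toMat_tab {N₁ N₂ : ℕ} (f : ℕ → ℕ → ℤ) :
    toMat N₁ N₂ (tab N₁ N₂ f) = fun (i : Fin N₁) (j : Fin N₂) => f i j := by
  funext i j
  exact ent_tab f i.isLt j.isLt

/-- A table has `N₁` rows. [folklore] -/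
@[simp] theorem length_tab (N₁ N₂ : ℕ) (f : ℕ → ℕ → ℤ) : (tab N₁ N₂ f).length = N₁ := by
  simp [tab]

/-- Every row of a table has `N₂` entries, each a value of `f`. [folklore] -/
theorem mem_tab {N₁ N₂ : ℕ} {f : ℕ → ℕ → ℤ} {r : List ℤ} (h : r ∈ tab N₁ N₂ f) :
    r.length = N₂ ∧ ∀ x ∈ r, ∃ i < N₁, ∃ j < N₂, x = f i j := by
  simp only [tab, List.mem_map, List.mem_range] at h
  obtain ⟨i, hi, rfl⟩ := h
  refine ⟨by simp, fun x hx => ?_⟩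
  simp only [List.mem_map, List.mem_range] at hx
  obtain ⟨j, hj, rfl⟩ := hx
  exact ⟨i, hi, j, hj, rfl⟩

/-- A list-range sum is a `Fin` sum. [folklore] -/
theorem sumRange_eq_sum (N : ℕ) (f : ℕ → ℤ) : sumRange N f = ∑ i : Fin N, f i := by
  induction N with
  | zero => simp [sumRange]
  | succ N ih =>
    rw [Fin.sum_univ_castSucc]
    simp only [Fin.val_castSucc, Fin.val_last]
    rw [← ih]
    simp [sumRange, List.range_succ]

/-! ### Products, identity, powers, trace, Gram matrix -/

/-- Schoolbook product of an `N₁ × N₂` by an `N₂ × N₃` list matrix. [cite: KnuthTAOCP2, §4.6.4] -/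
def mulL (N₁ N₂ N₃ : ℕ) (X Y : List (List ℤ)) : List (List ℤ) :=
  tab N₁ N₃ fun i j => sumRange N₂ fun l => ent X i l * ent Y l j

/-- **`mulL` is matrix multiplication.** [cite: KnuthTAOCP2, §4.6.4] -/
@[simp] theorem toMat_mulL (N₁ N₂ N₃ : ℕ) (X Y : List (List ℤ)) :
    toMat N₁ N₃ (mulL N₁ N₂ N₃ X Y) = toMat N₁ N₂ X * toMat N₂ N₃ Y := by
  rw [mulL, toMat_tab]
  funext i j
  rw [Matrix.mul_apply, sumRange_eq_sum]
  rfl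

/-- The identity list matrix. [folklore] -/
def oneL (N : ℕ) : List (List ℤ) := tab N N fun i j => if i = j then 1 else 0

/-- `oneL` is the identity matrix. [folklore] -/
@[simp] theorem toMat_oneL (N : ℕ) : toMat N N (oneL N) = 1 := by
  rw [oneL, toMat_tab]
  funext i j
  rw [Matrix.one_apply]
  simp [Fin.ext_iff]

/-- Powers by repeated multiplication on the right. [cite: KnuthTAOCP2, §4.6.3] -/
def powL (N : ℕ) (X : List (List ℤ)) : ℕ → List (List ℤ)
  | 0 => oneL N
  | t + 1 => mulL N N N (powL N X t) X

/-- **`powL` is the matrix power.** [cite: KnuthTAOCP2, §4.6.3] -/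
@[simp] theorem toMat_powL (N : ℕ) (X : List (List ℤ)) : ∀ t : ℕ, toMat N N (powL N X t) = toMat N N X ^ t
  | 0 => by rw [powL, toMat_oneL, pow_zero]
  | t + 1 => by rw [powL, toMat_mulL, toMat_powL N X t, pow_succ]

/-- The power as a fold over a unit budget (the loop of the machine). [folklore] -/
theorem foldl_mulL (N : ℕ) (X : List (List ℤ)) (l : List Unit) : ∀ t : ℕ,
    l.foldl (fun acc _ => mulL N N N acc X) (powL N X t) = powL N X (t + l.length) := by
  induction l with
  | nil => intro t; rfl
  | cons a l ih =>
    intro t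
    rw [List.foldl_cons, show mulL N N N (powL N X t) X = powL N X (t + 1) from rfl, ih,
      List.length_cons]
    congr 1
    omega

/-- The trace of a list matrix. [folklore] -/
def traceL (N : ℕ) (X : List (List ℤ)) : ℤ := sumRange N fun i => ent X i i

/-- **`traceL` is the trace.** [folklore] -/
theorem traceL_eq_trace (N : ℕ) (X : List (List ℤ)) : traceL N X = (toMat N N X).trace := by
  rw [traceL, sumRange_eq_sum, Matrix.trace]
  rfl

/-- The Gram matrix `BᵀB` of an `N₁ × N₂` list matrix, from its rows. [cite: KnuthTAOCP2, §4.6.4] -/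
def gramL (N₁ N₂ : ℕ) (B : List (List ℤ)) : List (List ℤ) :=
  tab N₂ N₂ fun j j' => sumRange N₁ fun u => ent B u j * ent B u j'

/-- **`gramL` is `BᵀB`.** [folklore] -/
@[simp] theorem toMat_gramL (N₁ N₂ : ℕ) (B : List (List ℤ)) :
    toMat N₂ N₂ (gramL N₁ N₂ B) = (toMat N₁ N₂ B)ᵀ * toMat N₁ N₂ B := by
  rw [gramL, toMat_tab]
  funext j j'
  rw [Matrix.mul_apply, sumRange_eq_sum]
  rfl

/-- **The machine's trace**: `traceL` of the `q`-fold product loop on `gramL B` is `tr((BᵀB)^q)`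
of the matrix of `B`. [Allen–O'Donnell–Witmer 2015, App. A.4 (the trace method)] [folklore] -/
theorem traceL_powL_gramL (N₁ N₂ : ℕ) (B : List (List ℤ)) (q : ℕ) :
    traceL N₂ (powL N₂ (gramL N₁ N₂ B) q) = (((toMat N₁ N₂ B)ᵀ * toMat N₁ N₂ B) ^ q).trace := by
  rw [traceL_eq_trace, toMat_powL, toMat_gramL]

/-! ### Re-indexing invariance of `tr((BᵀB)^t)` -/

/-- Powers commute with re-indexing by an equivalence. [folklore] -/
theorem submatrix_pow_equiv {l m : Type} [Fintype l] [Fintype m] [DecidableEq l] [DecidableEq m]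
    (M : Matrix m m ℤ) (e : l ≃ m) : ∀ t : ℕ, (M.submatrix e e) ^ t = (M ^ t).submatrix e e
  | 0 => by rw [pow_zero, pow_zero, Matrix.submatrix_one_equiv]
  | t + 1 => by rw [pow_succ, submatrix_pow_equiv M e t, Matrix.submatrix_mul_equiv, ← pow_succ]

/-- The trace is invariant under re-indexing by an equivalence. [folklore] -/
theorem trace_submatrix_equiv {l m : Type} [Fintype l] [Fintype m] (M : Matrix m m ℤ) (e : l ≃ m) :
    (M.submatrix e e).trace = M.trace := by
  simp only [Matrix.trace, Matrix.diag, Matrix.submatrix_apply]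
  exact Fintype.sum_equiv e _ _ fun _ => rfl

/-- **`tr((BᵀB)^t)` is invariant under re-indexing the rows and the columns of `B` by
equivalences.** [folklore] -/
theorem trace_pow_gram_submatrix {l m n o : Type} [Fintype l] [Fintype m] [Fintype n] [Fintype o]
    [DecidableEq n] [DecidableEq o] (M : Matrix m n ℤ) (e₁ : l ≃ m) (e₂ : o ≃ n) (t : ℕ) :
    (((M.submatrix e₁ e₂)ᵀ * M.submatrix e₁ e₂) ^ t).trace = ((Mᵀ * M) ^ t).trace := by
  rw [Matrix.transpose_submatrix, Matrix.submatrix_mul_equiv, submatrix_pow_equiv,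
    trace_submatrix_equiv]

/-! ### Entry bounds -/

/-- All entries (in range or not) are bounded by `β` in absolute value. [folklore] -/
def EntryBound (X : List (List ℤ)) (β : ℕ) : Prop := ∀ i j, (ent X i j).natAbs ≤ β

/-- Entries of a table are values (or `0`). [folklore] -/
theorem ent_tab_eq_or {N₁ N₂ : ℕ} (f : ℕ → ℕ → ℤ) (i j : ℕ) :
    ent (tab N₁ N₂ f) i j = f i j ∧ i < N₁ ∧ j < N₂ ∨ ent (tab N₁ N₂ f) i j = 0 := by
  by_cases hi : i < N₁
  · by_cases hj : j < N₂
    · exact Or.inl ⟨ent_tab f hi hj, hi, hj⟩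
    · right
      rw [ent, tab, getD_map_range _ hi, getD_map_range_of_le _ (not_lt.1 hj)]
  · right
    rw [ent, tab, getD_map_range_of_le _ (not_lt.1 hi)]
    rfl

/-- A table is entry-bounded by a bound on its function. [folklore] -/
theorem entryBound_tab {N₁ N₂ : ℕ} {f : ℕ → ℕ → ℤ} {β : ℕ} (h : ∀ i < N₁, ∀ j < N₂, (f i j).natAbs ≤ β) :
    EntryBound (tab N₁ N₂ f) β := by
  intro i j
  rcases ent_tab_eq_or f i j with ⟨h1, hi, hj⟩ | h0
  · rw [h1]; exact h i hi j hj
  · rw [h0]; simp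

/-- `|∑_{i<N} f i| ≤ N β` for `|f i| ≤ β`. [folklore] -/
theorem natAbs_sumRange_le {N : ℕ} {f : ℕ → ℤ} {β : ℕ} (h : ∀ i < N, (f i).natAbs ≤ β) :
    (sumRange N f).natAbs ≤ N * β := by
  induction N with
  | zero => simp [sumRange]
  | succ N ih =>
    have h1 := ih fun i hi => h i (by omega)
    have h2 := h N (by omega)
    simp only [sumRange, List.range_succ, List.map_append, List.map_singleton, List.sum_append,
      List.sum_singleton] at h1 ⊢
    calc _ ≤ ((List.map f (List.range N)).sum).natAbs + (f N).natAbs := Int.natAbs_add_le _ _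
      _ ≤ N * β + β := Nat.add_le_add h1 h2
      _ = (N + 1) * β := by ring

/-- **Entry bound of a product.** [folklore] -/
theorem entryBound_mulL {N₁ N₂ N₃ : ℕ} {X Y : List (List ℤ)} {β γ : ℕ} (hX : EntryBound X β)
    (hY : EntryBound Y γ) : EntryBound (mulL N₁ N₂ N₃ X Y) (N₂ * (β * γ)) := by
  refine entryBound_tab fun i _ j _ => natAbs_sumRange_le fun l _ => ?_
  rw [Int.natAbs_mul]
  exact Nat.mul_le_mul (hX i l) (hY l j)

/-- **Entry bound of a Gram matrix.** [folklore] -/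
theorem entryBound_gramL {N₁ N₂ : ℕ} {B : List (List ℤ)} {β : ℕ} (hB : EntryBound B β) :
    EntryBound (gramL N₁ N₂ B) (N₁ * (β * β)) := by
  refine entryBound_tab fun j _ j' _ => natAbs_sumRange_le fun u _ => ?_
  rw [Int.natAbs_mul]
  exact Nat.mul_le_mul (hB u j) (hB u j')

/-- The identity is entry-bounded by `1`. [folklore] -/
theorem entryBound_oneL (N : ℕ) : EntryBound (oneL N) 1 :=
  entryBound_tab fun i _ j _ => by split_ifs <;> simp

/-- **Entry bound of a power**: `|(X^t)ᵢⱼ| ≤ (max 1 (N β))^t`. [folklore] -/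
theorem entryBound_powL {N : ℕ} {X : List (List ℤ)} {β : ℕ} (hX : EntryBound X β) :
    ∀ t : ℕ, EntryBound (powL N X t) (max 1 (N * β) ^ t)
  | 0 => by rw [pow_zero]; exact entryBound_oneL N
  | t + 1 => by
    intro i j
    have h := entryBound_mulL (N₁ := N) (N₂ := N) (N₃ := N) (entryBound_powL (N := N) hX t) hX i j
    rw [powL]
    refine h.trans ?_
    rw [pow_succ]
    calc N * (max 1 (N * β) ^ t * β) = max 1 (N * β) ^ t * (N * β) := by ring
      _ ≤ max 1 (N * β) ^ t * max 1 (N * β) := Nat.mul_le_mul_left _ (le_max_right _ _)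

end LMat

end Literature.Computability.Complexity
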